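import Literature.MathematicalPhysics.PowerSystems.SMIBEnergyRegionOfAttraction
import Literature.Analysis.ODE.LipschitzFlow
import Summits.Ventures.GridStability.Models.OrbitGraph
import Mathlib.Analysis.SpecialFunctions.Trigonometric.Bounds
import Mathlib.Analysis.ODE.Gronwall
import Mathlib.Analysis.Calculus.Deriv.MeanValue
import Mathlib.Analysis.Calculus.Deriv.Slope
import HarnessLib

/-!
# GridStability/Models/SMIBOrbit — flow, uniqueness and first-swing facts for the classical SMIB model

Cell `gridfusion` (LADDER-GRIDFUSION G1-cct, SMIB threshold question), seat gridfusion-model-1,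
`plan/PARTITION.md` §0 row `Models/`.  Objects: lit-2's post-fault record
`Literature.MathematicalPhysics.PowerSystems.SMIB` (`M δ̈ = P_m − P_e^max sin δ − D δ̇`,
[cite: SauerPai1998, §9.6.2 eq. (9.30), Example 9.2]) with lit-6's energy well
(`SMIBEnergyRegionOfAttraction.lean`).  Everything is PROVED; no named facts.  Contents:

* `lipschitz_vectorField` — the swing field is globally Lipschitz (`|sin a − sin b| ≤ |a − b|`), hence
  `flow p hM` := `Literature.Analysis.ODE.lipschitzFlow` is its global flow: `flow_zero`,
  `hasDerivAt_flow(_fst/_snd)`, `flow_add`, `flow_isSolution`, and UNIQUENESS `eq_flow` — every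
  solution in the cell's within-`[0, S]` convention is the flow line of its initial state;
* potential-energy shape on the window: `potentialEnergy_antitoneOn` (`[0, δˢ]`),
  `potentialEnergy_strictMonoOn` (`[δˢ, π − δˢ]`), `potentialEnergy_le_max`,
  `potentialEnergy_lt_criticalEnergy` [cite: SauerPai1998, §9.6.2 (9.34), Fig. 9.8];
* fault-on facts for the zero-power fault `M ω̇ = P_m − D_f ω` from rest: `faultOn_speed_pos`
  (`ω > 0` for `t > 0`), `faultOn_angle_strictMonoOn` [cite: Kundur1994, Example 13.1];
* `exists_turn_of_tendsto` — the TURNING LEMMA: a post-fault motion that starts right of `δˢ` with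
  positive speed, keeps `δ < δˢ + π` and tends to `(δˢ, 0)` has a first swing that turns (`ω = 0`)
  at an angle `< π − δˢ` (at the turn `ω̇ ≤ 0`, i.e. `sin δ ≥ sin δˢ`, which on `(δˢ, δˢ + π)` forces
  `δ ≤ π − δˢ`; the u.e.p. itself is excluded by uniqueness).

MODELLED: classical SMIB (MODEL-VALIDITY row MV-1). No sentence here says a machine is stable.
-/

noncomputable section

open Real Set Filter Topology
open scoped NNReal

namespace Summit.Ventures.GridStability.Models.SMIBOrbit

variable (p : Literature.MathematicalPhysics.PowerSystems.SMIB)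

/-! ### The swing field is globally Lipschitz; the global flow; uniqueness -/

/-- A global Lipschitz constant of the swing field in the sup norm of `ℝ × ℝ`:
`max(1, (|P_e^max| + |D|)/M)`. [folklore] -/
def lipK : ℝ≥0 :=
  ⟨max 1 ((|p.Pmax| + |p.D|) / p.M), le_trans zero_le_one (le_max_left _ _)⟩

/-- The swing vector field `(δ, ω) ↦ (ω, (P_m − P_e^max sin δ − Dω)/M)` is globally Lipschitz
(`|sin a − sin b| ≤ |a − b|`). [cite: SauerPai1998, §9.6.2 eq. (9.30)] -/
theorem lipschitz_vectorField (hM : 0 < p.M) : LipschitzWith (lipK p) p.vectorField := by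
  apply LipschitzWith.of_dist_le_mul
  intro x y
  have hK : ((lipK p : ℝ≥0) : ℝ) = max 1 ((|p.Pmax| + |p.D|) / p.M) := rfl
  rw [Prod.dist_eq, Prod.dist_eq, Real.dist_eq, Real.dist_eq, Real.dist_eq, Real.dist_eq, hK]
  set d : ℝ := max |x.1 - y.1| |x.2 - y.2| with hd
  have hd0 : 0 ≤ d := le_trans (abs_nonneg _) (le_max_left _ _)
  have hK1 : (1 : ℝ) ≤ max 1 ((|p.Pmax| + |p.D|) / p.M) := le_max_left _ _
  have hK2 : (|p.Pmax| + |p.D|) / p.M ≤ max 1 ((|p.Pmax| + |p.D|) / p.M) := le_max_right _ _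
  have h1 : |Real.sin x.1 - Real.sin y.1| ≤ d :=
    (Real.abs_sin_sub_sin_le _ _).trans (le_max_left _ _)
  have h2 : |x.2 - y.2| ≤ d := le_max_right _ _
  refine max_le ?_ ?_
  · show |x.2 - y.2| ≤ _
    exact h2.trans (le_mul_of_one_le_left hd0 hK1)
  · show |p.accel x.1 x.2 - p.accel y.1 y.2| ≤ _
    have heq : p.accel x.1 x.2 - p.accel y.1 y.2 =
        (-(p.Pmax * (Real.sin x.1 - Real.sin y.1)) - p.D * (x.2 - y.2)) / p.M := by
      simp only [Literature.MathematicalPhysics.PowerSystems.SMIB.accel]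
      field_simp
      ring
    rw [heq, abs_div, abs_of_pos hM]
    have hnum : |-(p.Pmax * (Real.sin x.1 - Real.sin y.1)) - p.D * (x.2 - y.2)| ≤
        (|p.Pmax| + |p.D|) * d := by
      calc |-(p.Pmax * (Real.sin x.1 - Real.sin y.1)) - p.D * (x.2 - y.2)|
          ≤ |-(p.Pmax * (Real.sin x.1 - Real.sin y.1))| + |p.D * (x.2 - y.2)| := abs_sub _ _
        _ = |p.Pmax| * |Real.sin x.1 - Real.sin y.1| + |p.D| * |x.2 - y.2| := by
          rw [abs_neg, abs_mul, abs_mul]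
        _ ≤ |p.Pmax| * d + |p.D| * d := by gcongr
        _ = (|p.Pmax| + |p.D|) * d := by ring
    calc |-(p.Pmax * (Real.sin x.1 - Real.sin y.1)) - p.D * (x.2 - y.2)| / p.M
        ≤ (|p.Pmax| + |p.D|) * d / p.M := by gcongr
      _ = (|p.Pmax| + |p.D|) / p.M * d := by ring
      _ ≤ max 1 ((|p.Pmax| + |p.D|) / p.M) * d := mul_le_mul_of_nonneg_right hK2 hd0

/-- The GLOBAL FLOW of the swing equation (`Literature.Analysis.ODE.lipschitzFlow` of the Lipschitz
swing field): `flow p hM y t` is the state at time `t` of the motion through `y` at time `0`.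
[cite: SauerPai1998, §9.6.2 eq. (9.30)] -/
def flow (hM : 0 < p.M) : ℝ × ℝ → ℝ → ℝ × ℝ :=
  Literature.Analysis.ODE.lipschitzFlow (lipschitz_vectorField p hM)

variable {p}

/-- The flow line starts at `y`. [folklore] -/
@[simp]
theorem flow_zero (hM : 0 < p.M) (y : ℝ × ℝ) : flow p hM y 0 = y :=
  Literature.Analysis.ODE.lipschitzFlow_zero _ y

/-- Flow lines solve the swing equation (two-sided derivative at every time). [folklore] -/
theorem hasDerivAt_flow (hM : 0 < p.M) (y : ℝ × ℝ) (t : ℝ) :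
    HasDerivAt (flow p hM y) (p.vectorField (flow p hM y t)) t :=
  Literature.Analysis.ODE.hasDerivAt_lipschitzFlow _ y t

/-- Flow lines are continuous. [folklore] -/
theorem continuous_flow (hM : 0 < p.M) (y : ℝ × ℝ) : Continuous (flow p hM y) :=
  Literature.Analysis.ODE.continuous_lipschitzFlow _ y

/-- Group law `Φ y (s + t) = Φ (Φ y s) t`. [folklore] -/
theorem flow_add (hM : 0 < p.M) (y : ℝ × ℝ) (s t : ℝ) :
    flow p hM y (s + t) = flow p hM (flow p hM y s) t :=
  Literature.Analysis.ODE.lipschitzFlow_add _ y s t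

/-- Angle component of a flow line: `δ̇ = ω`. [folklore] -/
theorem hasDerivAt_flow_fst (hM : 0 < p.M) (y : ℝ × ℝ) (t : ℝ) :
    HasDerivAt (fun s => (flow p hM y s).1) (flow p hM y t).2 t := by
  have h := ((hasDerivAt_flow hM y t).hasFDerivAt.fst).hasDerivAt
  simpa [Literature.MathematicalPhysics.PowerSystems.SMIB.vectorField] using h

/-- Speed component of a flow line: `ω̇ = accel δ ω`. [folklore] -/
theorem hasDerivAt_flow_snd (hM : 0 < p.M) (y : ℝ × ℝ) (t : ℝ) :
    HasDerivAt (fun s => (flow p hM y s).2) (p.accel (flow p hM y t).1 (flow p hM y t).2) t := by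
  have h := ((hasDerivAt_flow hM y t).hasFDerivAt.snd).hasDerivAt
  simpa [Literature.MathematicalPhysics.PowerSystems.SMIB.vectorField] using h

/-- Flow lines are solutions in the cell's within-`[0, S]` convention. [folklore] -/
theorem flow_isSolution (hM : 0 < p.M) (y : ℝ × ℝ) :
    ∀ S : ℝ, ∀ t ∈ Icc 0 S, HasDerivWithinAt (flow p hM y) (p.vectorField (flow p hM y t))
      (Icc 0 S) t :=
  fun _ t _ => (hasDerivAt_flow hM y t).hasDerivWithinAt

/-- **Uniqueness**: every solution of the swing equation in the within-`[0, S]` convention is the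
flow line of its initial state (Picard–Lindelöf / Grönwall, Mathlib
`ODE_solution_unique_of_mem_Icc_right`). [folklore] -/
theorem eq_flow (hM : 0 < p.M) {X : ℝ → ℝ × ℝ}
    (hX : ∀ S : ℝ, ∀ t ∈ Icc 0 S, HasDerivWithinAt X (p.vectorField (X t)) (Icc 0 S) t)
    {t : ℝ} (ht : 0 ≤ t) : X t = flow p hM (X 0) t := by
  have hcont : ContinuousOn X (Icc 0 t) := fun τ hτ => (hX t τ hτ).continuousWithinAt
  have hder : ∀ τ ∈ Ico 0 t, HasDerivWithinAt X (p.vectorField (X τ)) (Ici τ) τ := fun τ hτ =>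
    (hX t τ (Ico_subset_Icc_self hτ)).mono_of_mem_nhdsWithin
      (mem_of_superset (Icc_mem_nhdsGE hτ.2) (Icc_subset_Icc hτ.1 le_rfl))
  have h := ODE_solution_unique_of_mem_Icc_right (v := fun _ => p.vectorField)
    (s := fun _ => (univ : Set (ℝ × ℝ))) (K := lipK p) (f := X) (g := flow p hM (X 0))
    (a := 0) (b := t) (fun _ _ => (lipschitz_vectorField p hM).lipschitzOnWith) hcont hder
    (fun _ _ => mem_univ _) (continuous_flow hM (X 0)).continuousOn
    (fun τ _ => (hasDerivAt_flow hM (X 0) τ).hasDerivWithinAt) (fun _ _ => mem_univ _)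
    (by rw [flow_zero])
  exact h ⟨ht, le_rfl⟩

/-! ### Shape of the potential energy on the angle window -/

/-- On `[δˢ, π − δˢ]` (`0 ≤ δˢ ≤ π/2`) the sine is at least `sin δˢ`. [folklore] -/
theorem sin_ge_sin_of_mem {δs x : ℝ} (h0 : 0 ≤ δs) (h1 : δs ≤ π / 2)
    (hx : x ∈ Icc δs (π - δs)) : Real.sin δs ≤ Real.sin x := by
  rcases le_or_gt x (π / 2) with hx2 | hx2
  · exact Real.sin_le_sin_of_le_of_le_pi_div_two (by linarith [Real.pi_pos]) hx2 hx.1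
  · rw [← Real.sin_pi_sub x]
    exact Real.sin_le_sin_of_le_of_le_pi_div_two (by linarith [Real.pi_pos]) (by linarith)
      (by linarith [hx.2])

/-- On `(δˢ, π − δˢ)` (`0 ≤ δˢ ≤ π/2`) the sine exceeds `sin δˢ`. [folklore] -/
theorem sin_gt_sin_of_mem {δs x : ℝ} (h0 : 0 ≤ δs) (h1 : δs ≤ π / 2)
    (hx : x ∈ Ioo δs (π - δs)) : Real.sin δs < Real.sin x := by
  rcases le_or_gt x (π / 2) with hx2 | hx2
  · exact Real.sin_lt_sin_of_lt_of_le_pi_div_two (by linarith [Real.pi_pos]) hx2 hx.1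
  · rw [← Real.sin_pi_sub x]
    exact Real.sin_lt_sin_of_lt_of_le_pi_div_two (by linarith [Real.pi_pos]) (by linarith)
      (by linarith [hx.2])

/-- `V_PE` is non-increasing on `[0, δˢ]` (`dV_PE/dδ = P_e^max(sin δ − sin δˢ) ≤ 0` there).
[cite: SauerPai1998, §9.6.2 eq. (9.34) and Fig. 9.8] -/
theorem potentialEnergy_antitoneOn (hPmax : 0 ≤ p.Pmax) {δs : ℝ} (heq : p.IsEquilibriumAngle δs)
    (h1 : δs ≤ π / 2) : AntitoneOn (p.potentialEnergy δs) (Icc 0 δs) := by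
  have hderiv : ∀ x, deriv (p.potentialEnergy δs) x = -p.Pm + p.Pmax * Real.sin x := fun x =>
    (p.hasDerivAt_potentialEnergy δs x).deriv
  refine antitoneOn_of_deriv_nonpos (convex_Icc 0 δs)
    (fun x _ => (p.hasDerivAt_potentialEnergy δs x).continuousAt.continuousWithinAt)
    (fun x _ => (p.hasDerivAt_potentialEnergy δs x).differentiableAt.differentiableWithinAt)
    fun x hx => ?_
  rw [interior_Icc] at hx
  rw [hderiv]
  unfold Literature.MathematicalPhysics.PowerSystems.SMIB.IsEquilibriumAngle at heq
  have hsin : Real.sin x ≤ Real.sin δs :=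
    Real.sin_le_sin_of_le_of_le_pi_div_two (by linarith [Real.pi_pos, hx.1]) h1 hx.2.le
  nlinarith

/-- `V_PE` is strictly increasing on `[δˢ, π − δˢ]` (`P_e^max > 0`; `sin δ > sin δˢ` inside).
[cite: SauerPai1998, §9.6.2 eq. (9.34) and Fig. 9.8] -/
theorem potentialEnergy_strictMonoOn (hPmax : 0 < p.Pmax) {δs : ℝ} (heq : p.IsEquilibriumAngle δs)
    (h0 : 0 ≤ δs) (h1 : δs ≤ π / 2) : StrictMonoOn (p.potentialEnergy δs) (Icc δs (π - δs)) := by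
  have hderiv : ∀ x, deriv (p.potentialEnergy δs) x = -p.Pm + p.Pmax * Real.sin x := fun x =>
    (p.hasDerivAt_potentialEnergy δs x).deriv
  refine strictMonoOn_of_deriv_pos (convex_Icc δs (π - δs))
    (fun x _ => (p.hasDerivAt_potentialEnergy δs x).continuousAt.continuousWithinAt)
    fun x hx => ?_
  rw [interior_Icc] at hx
  rw [hderiv]
  unfold Literature.MathematicalPhysics.PowerSystems.SMIB.IsEquilibriumAngle at heq
  have hsin : Real.sin δs < Real.sin x := sin_gt_sin_of_mem h0 h1 hx
  nlinarith

/-- **Quasi-convexity of `V_PE` on the window**: for `0 ≤ a ≤ δ ≤ b ≤ π − δˢ`,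
`V_PE(δ) ≤ max(V_PE(a), V_PE(b))`. [cite: SauerPai1998, §9.6.2 Fig. 9.8] -/
theorem potentialEnergy_le_max (hPmax : 0 < p.Pmax) {δs : ℝ} (heq : p.IsEquilibriumAngle δs)
    (h0 : 0 ≤ δs) (h1 : δs ≤ π / 2) {a b δ : ℝ} (ha : 0 ≤ a) (hb : b ≤ π - δs)
    (hδ : δ ∈ Icc a b) :
    p.potentialEnergy δs δ ≤ max (p.potentialEnergy δs a) (p.potentialEnergy δs b) := by
  rcases le_total δ δs with h | h
  · exact le_trans (potentialEnergy_antitoneOn hPmax.le heq h1 ⟨ha, hδ.1.trans h⟩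
      ⟨ha.trans hδ.1, h⟩ hδ.1) (le_max_left _ _)
  · exact le_trans ((potentialEnergy_strictMonoOn hPmax heq h0 h1).monotoneOn ⟨h, hδ.2.trans hb⟩
      ⟨h.trans hδ.2, hb⟩ hδ.2) (le_max_right _ _)

/-- **Below the rim**: if `0 ≤ a ≤ δ < π − δˢ` and `V_PE(a) < V_cr`, then `V_PE(δ) < V_cr`
(decreasing up to `δˢ`, then increasing towards `V_PE(π − δˢ) = V_cr`).
[cite: SauerPai1998, §9.6.2 eq. (9.34), §9.6.3 (9.46)–(9.47)] -/
theorem potentialEnergy_lt_criticalEnergy (hPmax : 0 < p.Pmax) {δs : ℝ}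
    (heq : p.IsEquilibriumAngle δs) (h0 : 0 ≤ δs) (h1 : δs ≤ π / 2) {a δ : ℝ} (ha : 0 ≤ a)
    (hVa : p.potentialEnergy δs a < p.criticalEnergy δs) (haδ : a ≤ δ) (hδ : δ < π - δs) :
    p.potentialEnergy δs δ < p.criticalEnergy δs := by
  rcases le_total δ δs with h | h
  · exact lt_of_le_of_lt (potentialEnergy_antitoneOn hPmax.le heq h1 ⟨ha, haδ.trans h⟩
      ⟨ha.trans haδ, h⟩ haδ) hVa
  · have hcr : p.potentialEnergy δs (π - δs) = p.criticalEnergy δs := by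
      have := p.energy_uep δs
      simpa [Literature.MathematicalPhysics.PowerSystems.SMIB.energy] using this
    rw [← hcr]
    exact potentialEnergy_strictMonoOn hPmax heq h0 h1 ⟨h, hδ.le⟩ ⟨by linarith, le_rfl⟩ hδ

/-- At zero speed the energy is the potential energy. [cite: SauerPai1998, §9.6.2 eq. (9.35)] -/
theorem energy_of_speed_zero (δs δ : ℝ) : p.energy δs (δ, 0) = p.potentialEnergy δs δ := by
  simp [Literature.MathematicalPhysics.PowerSystems.SMIB.energy]

/-! ### The zero-power fault-on motion from rest: strict facts -/

/-- Along `M ω̇ = P_m − D_f ω`, `ω(0) = 0` (`M > 0`, `P_m > 0`, `D_f ≥ 0`): `ω(t) > 0` for every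
`t ∈ (0, T]` (`ω e^{D_f t/M}` is strictly increasing). [cite: Kundur1994, Example 13.1] -/
theorem faultOn_speed_pos (hM : 0 < p.M) (hPm : 0 < p.Pm) {Df T : ℝ} (hDf : 0 ≤ Df) {ωF : ℝ → ℝ}
    (hω : ∀ t ∈ Icc 0 T, HasDerivWithinAt ωF ((p.Pm - Df * ωF t) / p.M) (Icc 0 T) t)
    (hω0 : ωF 0 = 0) {t : ℝ} (ht : t ∈ Ioc 0 T) : 0 < ωF t := by
  have _ := hDf
  set g : ℝ → ℝ := fun s => ωF s * Real.exp (Df * s / p.M) with hg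
  have hder : ∀ s ∈ Icc 0 T,
      HasDerivWithinAt g (Real.exp (Df * s / p.M) * (p.Pm / p.M)) (Icc 0 T) s := by
    intro s hs
    have hexp : HasDerivWithinAt (fun s => Real.exp (Df * s / p.M))
        (Real.exp (Df * s / p.M) * (Df / p.M)) (Icc 0 T) s := by
      have hlin : HasDerivAt (fun s : ℝ => Df * s / p.M) (Df / p.M) s := by
        have := (hasDerivAt_id s).const_mul Df |>.div_const p.M
        simpa using this
      exact ((Real.hasDerivAt_exp _).comp s hlin).hasDerivWithinAt
    have h := (hω s hs).mul hexp
    refine h.congr_deriv ?_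
    field_simp
    ring
  have hT : 0 < T := ht.1.trans_le ht.2
  have hmono : StrictMonoOn g (Icc 0 T) := by
    refine strictMonoOn_of_hasDerivWithinAt_pos (convex_Icc 0 T)
      (f' := fun s => Real.exp (Df * s / p.M) * (p.Pm / p.M))
      (fun s hs => (hder s hs).continuousWithinAt) (fun s hs => ?_) (fun s _ => ?_)
    · rw [interior_Icc] at hs ⊢
      exact ((hder s (Ioo_subset_Icc_self hs)).hasDerivAt (Icc_mem_nhds hs.1 hs.2)).hasDerivWithinAt
    · exact mul_pos (Real.exp_pos _) (div_pos hPm hM)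
  have hlt := hmono ⟨le_rfl, hT.le⟩ ⟨ht.1.le, ht.2⟩ ht.1
  have hg0 : g 0 = 0 := by simp [hg, hω0]
  rw [hg0] at hlt
  exact (mul_pos_iff_of_pos_right (Real.exp_pos _)).1 hlt

/-- Along the zero-power fault-on motion from rest the angle is STRICTLY increasing on `[0, T]`.
[cite: Kundur1994, Example 13.1] -/
theorem faultOn_angle_strictMonoOn (hM : 0 < p.M) (hPm : 0 < p.Pm) {Df T : ℝ} (hDf : 0 ≤ Df)
    {δF ωF : ℝ → ℝ} (hδ : ∀ t ∈ Icc 0 T, HasDerivWithinAt δF (ωF t) (Icc 0 T) t)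
    (hω : ∀ t ∈ Icc 0 T, HasDerivWithinAt ωF ((p.Pm - Df * ωF t) / p.M) (Icc 0 T) t)
    (hω0 : ωF 0 = 0) : StrictMonoOn δF (Icc 0 T) := by
  refine strictMonoOn_of_hasDerivWithinAt_pos (convex_Icc 0 T) (f' := ωF)
    (fun s hs => (hδ s hs).continuousWithinAt) (fun s hs => ?_) (fun s hs => ?_)
  · rw [interior_Icc] at hs ⊢
    exact ((hδ s (Ioo_subset_Icc_self hs)).hasDerivAt (Icc_mem_nhds hs.1 hs.2)).hasDerivWithinAt
  · rw [interior_Icc] at hs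
    exact faultOn_speed_pos hM hPm hDf hω hω0 ⟨hs.1, hs.2.le⟩

/-! ### The turning lemma -/

/-- **Turning lemma.** `M > 0`, `P_e^max > 0`, `δˢ ≤ π/2` an equilibrium angle.  A post-fault
solution `X` (within-`[0, S]` convention) with `ω(0) > 0`, `δ(0) > δˢ`, `δ(s) < δˢ + π` for all
`s ≥ 0` and `X → (δˢ, 0)` has a first swing that TURNS INSIDE THE WINDOW: some `s₂ ≥ 0` with
`ω(s₂) ≤ 0` and `δ < π − δˢ` on `[0, s₂]`.  (It must turn since `δ → δˢ < δ(0)`; at the first turn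
`ω̇ ≤ 0`, so `sin δ ≥ sin δˢ`, impossible on `(π − δˢ, δˢ + π)`; the u.e.p. `π − δˢ` is excluded by
uniqueness.) [cite: SauerPai1998, §9.6.2 (9.33)–(9.39) and Fig. 9.8] -/
theorem exists_turn_of_tendsto (hM : 0 < p.M) (hPmax : 0 < p.Pmax) {δs : ℝ}
    (heq : p.IsEquilibriumAngle δs) (h1 : δs ≤ π / 2) {X : ℝ → ℝ × ℝ}
    (hX : ∀ S : ℝ, ∀ t ∈ Icc 0 S, HasDerivWithinAt X (p.vectorField (X t)) (Icc 0 S) t)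
    (hω0 : 0 < (X 0).2) (hδ0 : δs < (X 0).1) (hwin : ∀ s, 0 ≤ s → (X s).1 < δs + π)
    (hlim : Tendsto X atTop (𝓝 (δs, 0))) :
    ∃ s₂, 0 ≤ s₂ ∧ (X s₂).2 ≤ 0 ∧ ∀ s ∈ Icc 0 s₂, (X s).1 < π - δs := by
  have hXΞ : ∀ s, 0 ≤ s → X s = flow p hM (X 0) s := fun s hs => eq_flow hM hX hs
  -- (a) the angle eventually drops below its initial value, so the speed is negative somewhere
  have hfst : Tendsto (fun s => (X s).1) atTop (𝓝 δs) :=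
    (continuous_fst.tendsto (δs, (0 : ℝ))).comp hlim
  obtain ⟨s, hs0, hs⟩ : ∃ s, 0 < s ∧ (X s).1 < (X 0).1 := by
    have h := (hfst.eventually (Iio_mem_nhds hδ0)).and (eventually_gt_atTop 0)
    obtain ⟨s, hs1, hs2⟩ := h.exists
    exact ⟨s, hs2, hs1⟩
  have hcont1 : Continuous fun s => (flow p hM (X 0) s).1 :=
    continuous_fst.comp (continuous_flow hM (X 0))
  have hcont2 : Continuous fun s => (flow p hM (X 0) s).2 :=
    continuous_snd.comp (continuous_flow hM (X 0))
  obtain ⟨c, hc, hcslope⟩ := exists_hasDerivAt_eq_slope (fun s => (flow p hM (X 0) s).1)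
    (fun s => (flow p hM (X 0) s).2) hs0 hcont1.continuousOn
    (fun x _ => hasDerivAt_flow_fst hM (X 0) x)
  have hneg : (flow p hM (X 0) c).2 < 0 := by
    rw [hcslope, ← hXΞ s hs0.le, ← hXΞ 0 le_rfl]
    exact div_neg_of_neg_of_pos (by linarith) (by linarith)
  -- (b) first turn of the flow line
  have hΞ0 : 0 < (flow p hM (X 0) 0).2 := by rw [← hXΞ 0 le_rfl]; exact hω0
  obtain ⟨s₁, hs₁, -, hzero, hpos⟩ :=
    OrbitGraph.exists_firstZero (ω := fun s => (flow p hM (X 0) s).2) hcont2 hΞ0 hc.1.le hneg.le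
  -- (c) the angle increases on [0, s₁]
  have hmono : MonotoneOn (fun s => (flow p hM (X 0) s).1) (Icc 0 s₁) := by
    refine (strictMonoOn_of_deriv_pos (convex_Icc 0 s₁) (f := fun s => (flow p hM (X 0) s).1)
      hcont1.continuousOn fun x hx => ?_).monotoneOn
    rw [interior_Icc] at hx
    rw [(hasDerivAt_flow_fst hM (X 0) x).deriv]
    exact hpos x ⟨hx.1.le, hx.2⟩
  have hδm1 : δs < (flow p hM (X 0) s₁).1 := by
    have h := hmono ⟨le_rfl, hs₁.le⟩ ⟨hs₁.le, le_rfl⟩ hs₁.le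
    dsimp only at h
    rw [← hXΞ 0 le_rfl] at h
    exact hδ0.trans_le h
  have hδm2 : (flow p hM (X 0) s₁).1 < δs + π := by
    have h := hwin s₁ hs₁.le
    rwa [hXΞ s₁ hs₁.le] at h
  -- (d) at the turn the acceleration is ≤ 0
  have hacc : p.accel (flow p hM (X 0) s₁).1 0 ≤ 0 := by
    have hd : HasDerivAt (fun s => (flow p hM (X 0) s).2)
        (p.accel (flow p hM (X 0) s₁).1 (flow p hM (X 0) s₁).2) s₁ :=
      hasDerivAt_flow_snd hM (X 0) s₁
    rw [hzero] at hd
    have hd' : HasDerivWithinAt (fun s => (flow p hM (X 0) s).2)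
        (p.accel (flow p hM (X 0) s₁).1 0) (Iio s₁) s₁ := hd.hasDerivWithinAt
    have ht := (hasDerivWithinAt_iff_tendsto_slope' (show s₁ ∉ Iio s₁ from lt_irrefl s₁)).1 hd'
    refine le_of_tendsto ht ?_
    filter_upwards [Ioo_mem_nhdsLT hs₁] with s hs
    rw [slope_def_field, hzero, sub_zero]
    exact (div_neg_of_pos_of_neg (hpos s ⟨hs.1.le, hs.2⟩) (by linarith [hs.2])).le
  have hsin : Real.sin δs ≤ Real.sin (flow p hM (X 0) s₁).1 := by
    unfold Literature.MathematicalPhysics.PowerSystems.SMIB.accel at hacc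
    unfold Literature.MathematicalPhysics.PowerSystems.SMIB.IsEquilibriumAngle at heq
    rw [mul_zero, sub_zero, div_nonpos_iff] at hacc
    rcases hacc with ⟨_, h⟩ | ⟨h, _⟩
    · exact absurd h (not_le.2 hM)
    · rw [heq] at h
      exact le_of_mul_le_mul_left (by linarith) hPmax
  -- (e) hence the turn is at an angle ≤ π − δs, and the u.e.p. is excluded
  have hδm3 : (flow p hM (X 0) s₁).1 ≤ π - δs := by
    by_contra h
    push Not at h
    have : Real.sin (flow p hM (X 0) s₁).1 < Real.sin δs := by
      rw [← Real.sin_pi_sub (flow p hM (X 0) s₁).1]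
      exact Real.sin_lt_sin_of_lt_of_le_pi_div_two (by linarith) h1 (by linarith)
    linarith
  have hδm4 : (flow p hM (X 0) s₁).1 ≠ π - δs := by
    intro h
    have hfix : p.vectorField (flow p hM (X 0) s₁) = 0 := by
      have hpt : flow p hM (X 0) s₁ = (π - δs, 0) := Prod.ext h hzero
      rw [hpt]
      exact p.vectorField_eq_zero_of_isEquilibriumAngle (p.isEquilibriumAngle_pi_sub heq)
    have hconst : ∀ t, flow p hM (flow p hM (X 0) s₁) t = flow p hM (X 0) s₁ := fun t =>
      Literature.Analysis.ODE.lipschitzFlow_eq_self_of_eq_zero _ hfix t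
    have h0' : X 0 = flow p hM (X 0) s₁ := by
      have h2 := flow_add hM (X 0) s₁ (-s₁)
      rw [add_neg_cancel, flow_zero] at h2
      exact h2.trans (hconst (-s₁))
    have : (X 0).2 = 0 := by rw [h0']; exact hzero
    linarith
  refine ⟨s₁, hs₁.le, ?_, fun t ht => ?_⟩
  · rw [hXΞ s₁ hs₁.le]
    exact hzero.le
  · rw [hXΞ t ht.1]
    have h := hmono ht ⟨hs₁.le, le_rfl⟩ ht.2
    dsimp only at h
    exact lt_of_le_of_lt h (lt_of_le_of_ne hδm3 hδm4)

end Summit.Ventures.GridStability.Models.SMIBOrbit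

end
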